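import Summits.BirchSwinnertonDyer.Rank1Residual.X11b.Three.UpperHalfShimuraCore
import Summits.BirchSwinnertonDyer.Rank1Residual.X11b.BDPRouteOpenInputOdd
import HarnessLib

/-!
# Class X11b at `p = 3` (team N8/O2, cell `b2b-bsdres`): the Euler-system half (T2′) on the Tamagawa sub-atom (T2β)∖(T2α) REDUCED to the two Shimura-curve displays, and `BSD(E,3)` with THE open input (sub-target T-O2-T2B@3, part 3b)

HONEST FRAMING (verbatim, cell `b2b-bsdres`, run/shared/lean/b2b/bsd-rank1-residual/): the goal of
the cell is to DELETE the COMBINATION-SHAPED residual classes for ALL analytic-rank `≤ 1` curves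
over `ℚ` — "full BSD formula for every rank `≤ 1` curve in class `C`" assembled STRICTLY from
published theorems — so that the rank-`≤ 1` remainder becomes exactly the CONSTRUCTION-SHAPED
classes, which are TYPED (missing-input Props), NOT attempted; this is not "finishing BSD".
Research route for class X11b (`ClassX11b W p := r_an = 1 ∧ p ≠ 2 ∧ mult(p) ∧ irr(p)`) at the prime
`p = 3`; no claim beyond the stated class and the sub-population named in each statement; nothing
booked; X11 ∧ `r = 1` at `p = 3` stays CONSTRUCTION-SHAPED (REFEREE R6.2). THEOREMS ONLY (no
definition, no named fact, no `sorry`).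

## What this file does

Continuation of `UpperHalfShimuraCore.lean`. At `p ≥ 5` multr1-p2 reduced the Euler-system half on
(T2′)∖(T2α) to the two Shimura-curve shapes at a Friedberg–Hoffstein field
(`missingUpperBoundAt_of_classX11b_of_ram_of_not_alpha`, `P2.bsdp_of_ram_of_not_alpha_endState`,
`5 ≤ p`); at `p = 3` the kernel of record types (T2′) WHOLESALE. Here the reduction is ported to
every ODD prime on the sub-population where it is print-faithful:

* (β) every prime `ℓ` with `p ∣ c_ℓ(E)` is MULTIPLICATIVE — at `p = 3` an ADDITIVE prime of Kodaira
  type IV / IV* has `c_ℓ = 3` (impossible for `p ≥ 5`), and only multiplicative primes can be put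
  into `N⁻`; the complementary sub-atom (T2γ)@3 of (T2′)@3 stays typed wholesale;
* `2 ∣ N_E` — then the Friedberg–Hoffstein field of the tree's named fact
  `friedbergHoffstein_exists_twist_ne_zero_inertAt` (bad primes split or inert, hence unramified)
  has `d_K` ODD automatically, and the ramified primes `ℓ ∣ d_K` (good for `E`, `ℓ ≥ 5`) carry
  `c_ℓ(E^{d_K}) ∈ {1,2,4}` (type `I₀*`, tree theorem `X2.padicValNat_localTamagawaNumber_twist_of_dvd`).
  For `2 ∤ N_E` the named fact does not control the prime `2` (it may ramify in `K`; `c_2(E^{d_K})`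
  is then `∈ {1,2,4}` numerically — kit job j119744: 398 072 ramified-at-`2` twists of curves good at
  `2`, Kodaira types II/II*/I₄*/I₈* only — but that is not a tree theorem); the honest repair is the
  field SOURCE (Friedberg–Hoffstein Thm. B with the `2`-adic component prescribed, the "general
  form" flagged `TODO` in `NonvanishingTwistsPrescribedInert.lean`), recorded here as the variant
  `…_of_oddField_odd` whose odd-`d_K` field is a HYPOTHESIS.

Contents:
* **`missingUpperBoundAt_of_classX11b_of_ram_of_beta_of_two_dvd_odd`** — X11b ∧ `p` odd ∧ (ram) ∧
  ¬(T2α) ∧ (β) ∧ `2 ∣ N_E`: `Typed.MissingUpperBoundAt W p` ⇐ PUBLISHED (`hSk` Skinner 2016 Thm. C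
  [printed for `p ≥ 3`], `hGZK`, `hmod`, `hnf`, `hFH`) + (T2♯) the two Shimura shapes at every JSW
  field of the pair [print-only content: (U-Sh) = JSW Thm. 4.4.1 / Nekovář 2007, (GZ-Sh) =
  Cai–Shu–Tian 2014 Thm. 1.5 with Ribet–Takahashi / Pasten §6; their `p`-range at `p = 3` is for the
  team's literature seat to quote — until then the binder is OPEN at `3`];
* `missingUpperBoundAt_of_classX11b_of_ram_of_beta_of_oddField_odd` — the same for ANY conductor,
  the odd-`d_K` Friedberg–Hoffstein field entering as an explicit hypothesis (NOT a tree fact);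
* **`P2.bsdp_of_ram_of_beta_of_two_dvd_odd`**, `P2.bsdp_three_of_ram_of_beta_of_two_dvd` —
  `BSD(E,p)` on that sub-population from the twelve published facts of the route, THE open input
  `P2OpenInputOnTreeOddAt W p` [at `p ∥ N`, `p ≥ 5`: erratum (2.4) ⇐ FW21 4.41, UNREFEREED; at
  `p = 3`: NO source, not even announced] and (T2♯); `ρ̄_{E,p}` onto is automatic
  (`surj_of_irr_of_ram`).

The census of the sub-partition (T2′)@3 = (T2α) ∪ (T2β∖α)[2∣N / 2∤N] ∪ (T2γ) is EVIDENCE kept in the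
team folder (HOME/b2b-bsdres-x11b3-p4/census/), not here. CONDITIONAL on the named facts and the
typed inputs in each signature; nothing booked; reach and labels UNCHANGED.

References: [JetchevSkinnerWan2017] §7.4.2 (p. 31), §4.1 (H) (p. 17), Thm. 4.4.1 (p. 19);
[FriedbergHoffstein1995] Thm. B; [Skinner2016PacificMC] Thm. C and footnote 1; [Castella2018]
Thm. 2.3, Thm. 3.2; [Castella2018Erratum] (2.4); [Wuthrich2014] Prop. 21; [Miller2011LMS] Def. 1.1;
[SilvermanATAEC1994] IV.9.4, Cor. IV.9.2(d).
-/

noncomputable section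

open scoped Classical

open WeierstrassCurve NumberField IsDedekindDomain Literature.NumberTheory.EllipticCurves
  Rat.HeightOneSpectrum
  Literature.NumberTheory.EllipticCurves.ModularForms
  Literature.NumberTheory.EllipticCurves.Rank1Residual
  Literature.NumberTheory.EllipticCurves.Rank1Residual.Typed
  Literature.NumberTheory.EllipticCurves.Wuthrich2014
  Literature.NumberTheory.EllipticCurves.BalakrishnanEtAl2019
  Literature.NumberTheory.QuadraticFields.Quadratic
  Literature.NumberTheory.GaloisRepresentations Literature.NumberTheory.GaloisCohomology

namespace Summit.BirchSwinnertonDyer.Rank1Residual.X11b.Three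

/-! ### The field of JSW §7.4.2 constructed (Friedberg–Hoffstein), `d_K` odd because `2 ∣ N_E` -/

section Upper

variable (W : WeierstrassCurve ℚ) [W.IsElliptic] [W.IsGloballyMinimal] (p : ℕ) [Fact p.Prime]

/-- **X11b ∧ `p` odd ∧ (ram) ∧ ¬(T2α) ∧ (β) ∧ `2 ∣ N_E`: the Euler-system half from the two
Shimura-curve displays — `p = 3` included.** PUBLISHED inputs: `hSk` (Skinner 2016 Thm. C, printed
for `p ≥ 3`), `hGZK`, `hmod`, `hnf` (modularity: the sign is `(−1)^{r_an} = −1`), and `hFH` =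
Friedberg–Hoffstein 1995 Thm. B in the special case of Jetchev–Skinner–Wan 2017 §7.4.2 (the tree's
named fact `friedbergHoffstein_exists_twist_ne_zero_inertAt`: "`S` inert, the other primes of `N`
split, `L(E^{D″},1) ≠ 0`"). TYPED input (T2♯) AT THE PAIR: for every even finite set `S` of
multiplicative primes of `E` inert in an imaginary quadratic `K` with the other bad primes split and
the split multiplicative primes outside `S` très ramifié, and every globally minimal model of
`E^{d_K}` with `L(E^{d_K},1) ≠ 0`, SOME point `P ∈ E(K)` carries (U-Sh) and (GZ-Sh) with
`T = Σ_{ℓ∈S} ord_p(ord_ℓ Δ_min(E))` — print-only content (JSW Thm. 4.4.1 on `X_{N⁺,N⁻}`, the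
explicit Gross–Zagier formula on `X_{N⁺,N⁻}`); verbatim the `p ≥ 5` binder `hSh` of
`missingUpperBoundAt_of_classX11b_of_ram_of_not_alpha` read at this pair, without its antecedent
`5 ≤ p` [the `p`-range of its printed sources at `p = 3` is NOT asserted here: OPEN at `3` until
quoted]. The proof takes `S` from `exists_inertSet` and the field from `hFH`; `2 ∣ N_E` makes `2`
split or inert in `K`, so `d_K` is odd (`odd_discr_of_two_dvd`), and `p ∣ N_E` splits, so `p ∤ d_K`.
CONCLUSION: `Typed.MissingUpperBoundAt W p` for an X11b pair (`p` odd) with a (ram) prime, not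
split-and-peu-ramifié at `p`, `p ∤ c_ℓ(E)` at the additive primes, and even conductor.
CONDITIONAL on (T2♯); nothing booked; X11b / X11 ∧ `r = 1` at `p = 3` stay CONSTRUCTION-SHAPED.
[cite: JetchevSkinnerWan2017, §7.4.2 (p. 31), §4.1 (p. 17), Thm. 4.4.1 (p. 19)]
[cite: FriedbergHoffstein1995, Thm. B] [cite: Skinner2016PacificMC, Thm. C (§1) and footnote 1]
[cite: SilvermanATAEC1994, IV.9.4 Steps 2, 5, 6, 8 and Table 4.1] [cite: Miller2011LMS, Def. 1.1] -/
theorem missingUpperBoundAt_of_classX11b_of_ram_of_beta_of_two_dvd_odd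
    -- published inputs (named facts of the tree)
    (hSk : Skinner2016.thmC_padicValRat_bsd_rank_zero)
    (hGZK : rank_eq_analyticRank_of_analyticRank_le_one) (hmod : hasEntireLFunction_rat)
    (hnf : exists_isNewformOf)
    -- Friedberg–Hoffstein 1995 Thm. B, the special case of JSW §7.4.2 (named fact of the tree)
    (hFH : friedbergHoffstein_exists_twist_ne_zero_inertAt)
    -- (T2♯) the two Shimura-curve shapes at every JSW field of the pair
    (hSh : ∀ (K : Type) [Field K] [NumberField K] (S : Finset ℕ)
      (Wd : WeierstrassCurve ℚ) [Wd.IsElliptic] [Wd.IsGloballyMinimal] (Cd : VariableChange ℚ),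
      IsImaginaryQuadratic K → Even S.card →
      (∀ ℓ ∈ S, ∃ _ : Fact ℓ.Prime, Mult W ℓ ∧
        ((ℓ ≠ 2 ∧ jacobiSym (NumberField.discr K) ℓ = -1) ∨ (ℓ = 2 ∧ NumberField.discr K % 8 = 5))) →
      (∀ (ℓ : ℕ) [Fact ℓ.Prime], ¬ W.HasGoodReductionAtPrime ℓ → ℓ ∉ S →
        IsSquare (algebraMap ℚ ℚ_[ℓ] (NumberField.discr K : ℚ))) →
      (∀ (ℓ : ℕ) [Fact ℓ.Prime], ℓ ∉ S → W.HasSplitMultiplicativeReductionAtPrime ℓ →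
        ¬ p ∣ padicValInt ℓ W.minimalDiscriminantInt) →
      Cd • W.quadraticTwist (NumberField.discr K : ℚ) = Wd →
      (W.quadraticTwist (NumberField.discr K : ℚ)).entireLFunction 1 ≠ 0 →
      ∃ P : (W.baseChange K).toAffine.Point,
        (∃ qE qd : ℚ, qE ≠ 0 ∧ qd ≠ 0 ∧
          W.leadingLCoeff / ((W.realPeriodRat : ℂ) * (W.regulator : ℂ)) = (qE : ℂ) ∧
          Wd.entireLFunction 1 / (Wd.realPeriodRat : ℂ) = (qd : ℂ) ∧
          (2 * padicValNat p (AddSubgroup.zmultiples P).index : ℤ) +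
              (∑ ℓ ∈ S, padicValNat p (padicValInt ℓ W.minimalDiscriminantInt) : ℕ) =
            padicValRat p qE + padicValRat p qd) ∧
        Nat.card (AddCommGroup.primaryComponent (W.baseChange K).sha p) ≤
          p ^ (2 * padicValNat p (AddSubgroup.zmultiples P).index))
    -- the pair: (ram), not (T2α), (β), even conductor
    (hX : ClassX11b W p) (hram : Ram W p)
    (hα : ¬ (W.HasSplitMultiplicativeReductionAtPrime p ∧ p ∣ padicValInt p W.minimalDiscriminantInt))
    (hβ : ∀ (ℓ : ℕ) [Fact ℓ.Prime], ¬ W.HasGoodReductionAtPrime ℓ → ¬ Mult W ℓ →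
      ¬ p ∣ (W.baseChange ℚ_[ℓ]).localTamagawaNumber ℤ_[ℓ])
    (h2N : 2 ∣ W.conductorNorm ℤ) :
    Typed.MissingUpperBoundAt W p := by
  obtain ⟨hr, hp2, hmult, hirr⟩ := id hX
  -- the sign of the functional equation is `−1` (modularity, `r_an = 1`)
  have hw : W.rootNumber = -1 := by
    rw [WeierstrassCurve.rootNumber_eq_neg_one_pow_analyticRank_of_exists_isNewformOf hnf W, hr]
    norm_num
  obtain ⟨ℓ₀, hℓ₀F, hℓ₀p, hmult₀, hram₀⟩ := id hram
  obtain ⟨S, hSeven, hpS, hSmult, hFC⟩ := exists_inertSet W p hram hα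
  -- the field of JSW §7.4.2 (Friedberg–Hoffstein)
  obtain ⟨K, _, _, hK, -, hinert, hsplitN, hLt⟩ := hFH W hw S hSmult hSeven 0
  obtain ⟨hSin, hsplit, hpd⟩ := localData_of_field W hp2 hmult hK.1 hpS hSmult hinert hsplitN
  have hodd : Odd (NumberField.discr K) := odd_discr_of_two_dvd W hK.1 hinert hsplitN h2N
  -- a globally minimal model of the twist
  have hD0 : (NumberField.discr K : ℚ) ≠ 0 := by exact_mod_cast NumberField.discr_ne_zero K
  haveI hEt : (W.quadraticTwist (NumberField.discr K : ℚ)).IsElliptic :=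
    W.isElliptic_quadraticTwist hD0
  obtain ⟨Cd, hCd⟩ := hasGlobalMinimalModel_rat_holds (W.quadraticTwist (NumberField.discr K : ℚ))
  haveI : (Cd • W.quadraticTwist (NumberField.discr K : ℚ)).IsGloballyMinimal := hCd
  -- the two shapes at the CM point (typed input)
  obtain ⟨P, hGZSh, hUSh⟩ := hSh K S (Cd • W.quadraticTwist (NumberField.discr K : ℚ)) Cd hK hSeven
    hSin hsplit hFC rfl hLt
  exact missingUpperBoundAt_of_classX11b_of_shimuraShapes_inertSet_odd hSk hGZK hmod W p hX hℓ₀p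
    hmult₀ hram₀ hβ K hK hodd S hpS hSin hsplit hpd hFC hLt
    (Cd • W.quadraticTwist (NumberField.discr K : ℚ)) Cd rfl P hGZSh hUSh

/-- **X11b ∧ `p` odd ∧ (ram) ∧ ¬(T2α) ∧ (β), ANY conductor: the Euler-system half from the two
Shimura-curve displays, the odd-`d_K` Friedberg–Hoffstein field entering as a HYPOTHESIS.** As
`missingUpperBoundAt_of_classX11b_of_ram_of_beta_of_two_dvd_odd`, with the field source `hFHodd` —
Friedberg–Hoffstein 1995 Thm. B with, besides "`S` inert, the other bad primes split", the `2`-adic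
component prescribed so that `d_K` is ODD — stated INLINE as a hypothesis: a special case of the
printed Thm. B (arbitrary prescribed quadratic local behaviour at finitely many places) but NOT (yet)
a named fact of the tree (`friedbergHoffstein_exists_twist_ne_zero_inertAt` flags the general form as
`TODO`). With `d_K` odd the ramified primes are `≥ 5` and the tree theorem
`X2.padicValNat_localTamagawaNumber_twist_of_dvd` (type `I₀*`) applies; without it a ramified `2`
(`E` good at `2`) would need the `2`-adic Kodaira types of the twist (II/II*/I₄*/I₈*, `c ∈ {1,2,4}`
on 398 072/398 072 twists, kit job j119744 — NOT a tree theorem). CONDITIONAL on `hFHodd` and (T2♯);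
nothing booked; labels unchanged. [cite: JetchevSkinnerWan2017, §7.4.2 (p. 31), §4.1 (p. 17), Thm. 4.4.1 (p. 19)]
[cite: FriedbergHoffstein1995, Thm. B] [cite: Skinner2016PacificMC, Thm. C (§1) and footnote 1] [cite: Miller2011LMS, Def. 1.1] -/
theorem missingUpperBoundAt_of_classX11b_of_ram_of_beta_of_oddField_odd
    -- published inputs (named facts of the tree)
    (hSk : Skinner2016.thmC_padicValRat_bsd_rank_zero)
    (hGZK : rank_eq_analyticRank_of_analyticRank_le_one) (hmod : hasEntireLFunction_rat)
    (hnf : exists_isNewformOf)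
    -- Friedberg–Hoffstein Thm. B with the `2`-adic condition (NOT a tree fact; hypothesis)
    (hFHodd : ∀ (W : WeierstrassCurve ℚ) [W.IsElliptic], W.rootNumber = -1 →
      ∀ (S : Finset ℕ), (∀ ℓ ∈ S, ∃ _ : Fact ℓ.Prime, W.HasMultiplicativeReductionAtPrime ℓ) →
        Even S.card →
      ∃ (K : Type) (_ : Field K) (_ : NumberField K),
        IsImaginaryQuadratic K ∧ Odd (NumberField.discr K) ∧
          (∀ ℓ ∈ S, ((Ideal.span {(ℓ : ℤ)}).primesOver (𝓞 K)).ncard = 1 ∧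
            ¬ (ℓ : ℤ) ∣ NumberField.discr K) ∧
          (∀ ℓ : ℕ, ℓ.Prime → ℓ ∣ W.conductorNorm ℤ → ℓ ∉ S →
            ((Ideal.span {(ℓ : ℤ)}).primesOver (𝓞 K)).ncard = 2) ∧
          (W.quadraticTwist (NumberField.discr K : ℚ)).entireLFunction 1 ≠ 0)
    -- (T2♯) the two Shimura-curve shapes at every JSW field of the pair
    (hSh : ∀ (K : Type) [Field K] [NumberField K] (S : Finset ℕ)
      (Wd : WeierstrassCurve ℚ) [Wd.IsElliptic] [Wd.IsGloballyMinimal] (Cd : VariableChange ℚ),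
      IsImaginaryQuadratic K → Even S.card →
      (∀ ℓ ∈ S, ∃ _ : Fact ℓ.Prime, Mult W ℓ ∧
        ((ℓ ≠ 2 ∧ jacobiSym (NumberField.discr K) ℓ = -1) ∨ (ℓ = 2 ∧ NumberField.discr K % 8 = 5))) →
      (∀ (ℓ : ℕ) [Fact ℓ.Prime], ¬ W.HasGoodReductionAtPrime ℓ → ℓ ∉ S →
        IsSquare (algebraMap ℚ ℚ_[ℓ] (NumberField.discr K : ℚ))) →
      (∀ (ℓ : ℕ) [Fact ℓ.Prime], ℓ ∉ S → W.HasSplitMultiplicativeReductionAtPrime ℓ →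
        ¬ p ∣ padicValInt ℓ W.minimalDiscriminantInt) →
      Cd • W.quadraticTwist (NumberField.discr K : ℚ) = Wd →
      (W.quadraticTwist (NumberField.discr K : ℚ)).entireLFunction 1 ≠ 0 →
      ∃ P : (W.baseChange K).toAffine.Point,
        (∃ qE qd : ℚ, qE ≠ 0 ∧ qd ≠ 0 ∧
          W.leadingLCoeff / ((W.realPeriodRat : ℂ) * (W.regulator : ℂ)) = (qE : ℂ) ∧
          Wd.entireLFunction 1 / (Wd.realPeriodRat : ℂ) = (qd : ℂ) ∧
          (2 * padicValNat p (AddSubgroup.zmultiples P).index : ℤ) +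
              (∑ ℓ ∈ S, padicValNat p (padicValInt ℓ W.minimalDiscriminantInt) : ℕ) =
            padicValRat p qE + padicValRat p qd) ∧
        Nat.card (AddCommGroup.primaryComponent (W.baseChange K).sha p) ≤
          p ^ (2 * padicValNat p (AddSubgroup.zmultiples P).index))
    (hX : ClassX11b W p) (hram : Ram W p)
    (hα : ¬ (W.HasSplitMultiplicativeReductionAtPrime p ∧ p ∣ padicValInt p W.minimalDiscriminantInt))
    (hβ : ∀ (ℓ : ℕ) [Fact ℓ.Prime], ¬ W.HasGoodReductionAtPrime ℓ → ¬ Mult W ℓ →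
      ¬ p ∣ (W.baseChange ℚ_[ℓ]).localTamagawaNumber ℤ_[ℓ]) :
    Typed.MissingUpperBoundAt W p := by
  obtain ⟨hr, hp2, hmult, hirr⟩ := id hX
  have hw : W.rootNumber = -1 := by
    rw [WeierstrassCurve.rootNumber_eq_neg_one_pow_analyticRank_of_exists_isNewformOf hnf W, hr]
    norm_num
  obtain ⟨ℓ₀, hℓ₀F, hℓ₀p, hmult₀, hram₀⟩ := id hram
  obtain ⟨S, hSeven, hpS, hSmult, hFC⟩ := exists_inertSet W p hram hα
  -- the odd-`d_K` field (hypothesis)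
  obtain ⟨K, _, _, hK, hodd, hinert, hsplitN, hLt⟩ := hFHodd W hw S hSmult hSeven
  obtain ⟨hSin, hsplit, hpd⟩ := localData_of_field W hp2 hmult hK.1 hpS hSmult hinert hsplitN
  have hD0 : (NumberField.discr K : ℚ) ≠ 0 := by exact_mod_cast NumberField.discr_ne_zero K
  haveI hEt : (W.quadraticTwist (NumberField.discr K : ℚ)).IsElliptic :=
    W.isElliptic_quadraticTwist hD0
  obtain ⟨Cd, hCd⟩ := hasGlobalMinimalModel_rat_holds (W.quadraticTwist (NumberField.discr K : ℚ))
  haveI : (Cd • W.quadraticTwist (NumberField.discr K : ℚ)).IsGloballyMinimal := hCd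
  obtain ⟨P, hGZSh, hUSh⟩ := hSh K S (Cd • W.quadraticTwist (NumberField.discr K : ℚ)) Cd hK hSeven
    hSin hsplit hFC rfl hLt
  exact missingUpperBoundAt_of_classX11b_of_shimuraShapes_inertSet_odd hSk hGZK hmod W p hX hℓ₀p
    hmult₀ hram₀ hβ K hK hodd S hpS hSin hsplit hpd hFC hLt
    (Cd • W.quadraticTwist (NumberField.discr K : ℚ)) Cd rfl P hGZSh hUSh

end Upper

/-! ### `BSD(E,p)` on the sub-population, with THE open input -/

section BSD

variable (W : WeierstrassCurve ℚ) [W.IsElliptic] [W.IsGloballyMinimal] (p : ℕ) [Fact p.Prime]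

/-- **Route p2 at an ODD prime on X11b ∧ (ram) ∧ ¬(T2α) ∧ (β) ∧ `2 ∣ N_E` — `p = 3` included.**
`BSD(E,p)` from: the published named facts of the route (Gross–Zagier, Kolyvagin, Skinner 2016
Thm. C [`p ≥ 3`], Wuthrich 2014 Prop. 21, GZK, modularity ×2, Hoffstein–Luo, Friedberg–Hoffstein
(JSW's special case), Mazur 1978 Cor. 4.1, Poitou–Tate, local Euler characteristic), THE open
input `P2OpenInputOnTreeOddAt W p` at the pair [(IMC≥∘BDP)ᵗ; at `p ∥ N`, `p ≥ 5`: erratum (2.4) ⇐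
FW21 Thm. 4.41, UNREFEREED; at `p = 3`: NO source, not even announced], and (T2♯) the two
Shimura-curve shapes at every JSW field of the pair [print-only content; `p`-range at `3` not
asserted]. The main-conjecture half is `P2.missingLowerBoundAt_of_openInputOddAt` (`ρ̄_{E,p}` onto
from irreducible + (ram), `surj_of_irr_of_ram`); the Euler-system half is
`missingUpperBoundAt_of_classX11b_of_ram_of_beta_of_two_dvd_odd`. Compared with the kernel of record
at odd `p` (`bsdp_of_classX11b_odd_of_onTreeInputs`, binder `hU` = the WHOLE Euler-system half off
`(ram) ∧ p ∤ ∏c`), the typed residue on this sub-population is the print-shaped (T2♯) instead of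
`Typed.MissingUpperBoundAt` wholesale. CONDITIONAL; nothing booked; labels UNCHANGED.
[cite: JetchevSkinnerWan2017, §7.4.1–7.4.2 (pp. 30–31), Thm. 4.4.1 (p. 19)] [cite: FriedbergHoffstein1995, Thm. B]
[cite: Castella2018, Thm. 2.3 (p. 5), Thm. 3.2 (p. 9)] [cite: Castella2018Erratum, (2.4) (p. 1)]
[cite: Skinner2016PacificMC, Thm. C (§1) and footnote 1] [cite: Wuthrich2014, Prop. 21 (p. 400)] [cite: Miller2011LMS, Def. 1.1] -/
theorem P2.bsdp_of_ram_of_beta_of_two_dvd_odd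
    (hGZ : ∀ (N : ℕ) [NeZero N] (W : WeierstrassCurve ℚ) (K : Type) [Field K] [NumberField K],
      gross_zagier N W K)
    (hKo : ∀ (N : ℕ) [NeZero N] (W : WeierstrassCurve ℚ) (K : Type) [Field K] [NumberField K],
      kolyvagin N W K)
    (hSk : Skinner2016.thmC_padicValRat_bsd_rank_zero) (hWu : sha_dvd_analyticSha)
    (hGZK : rank_eq_analyticRank_of_analyticRank_le_one) (hmod : hasEntireLFunction_rat)
    (hnf : exists_isNewformOf) (hHL : HoffsteinLuo1997_exists_twist_L_one_ne_zero)
    (hFH : friedbergHoffstein_exists_twist_ne_zero_inertAt)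
    (hMaz : mazur_not_dvd_maninConstant_of_odd)
    (hPT : ∀ (K : Type) [Field K] [NumberField K], poitouTate_sum_localTatePairing_eq_zero K)
    (hEP : ∀ (K : Type) [Field K] [NumberField K] (v : HeightOneSpectrum (𝓞 K)),
      localEulerPoincareCharacteristic (v.adicCompletion K))
    -- THE open input at this pair (odd form)
    (hA : P2OpenInputOnTreeOddAt W p)
    -- (T2♯) the two Shimura-curve shapes at every JSW field of the pair
    (hSh : ∀ (K : Type) [Field K] [NumberField K] (S : Finset ℕ)
      (Wd : WeierstrassCurve ℚ) [Wd.IsElliptic] [Wd.IsGloballyMinimal] (Cd : VariableChange ℚ),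
      IsImaginaryQuadratic K → Even S.card →
      (∀ ℓ ∈ S, ∃ _ : Fact ℓ.Prime, Mult W ℓ ∧
        ((ℓ ≠ 2 ∧ jacobiSym (NumberField.discr K) ℓ = -1) ∨ (ℓ = 2 ∧ NumberField.discr K % 8 = 5))) →
      (∀ (ℓ : ℕ) [Fact ℓ.Prime], ¬ W.HasGoodReductionAtPrime ℓ → ℓ ∉ S →
        IsSquare (algebraMap ℚ ℚ_[ℓ] (NumberField.discr K : ℚ))) →
      (∀ (ℓ : ℕ) [Fact ℓ.Prime], ℓ ∉ S → W.HasSplitMultiplicativeReductionAtPrime ℓ →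
        ¬ p ∣ padicValInt ℓ W.minimalDiscriminantInt) →
      Cd • W.quadraticTwist (NumberField.discr K : ℚ) = Wd →
      (W.quadraticTwist (NumberField.discr K : ℚ)).entireLFunction 1 ≠ 0 →
      ∃ P : (W.baseChange K).toAffine.Point,
        (∃ qE qd : ℚ, qE ≠ 0 ∧ qd ≠ 0 ∧
          W.leadingLCoeff / ((W.realPeriodRat : ℂ) * (W.regulator : ℂ)) = (qE : ℂ) ∧
          Wd.entireLFunction 1 / (Wd.realPeriodRat : ℂ) = (qd : ℂ) ∧
          (2 * padicValNat p (AddSubgroup.zmultiples P).index : ℤ) +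
              (∑ ℓ ∈ S, padicValNat p (padicValInt ℓ W.minimalDiscriminantInt) : ℕ) =
            padicValRat p qE + padicValRat p qd) ∧
        Nat.card (AddCommGroup.primaryComponent (W.baseChange K).sha p) ≤
          p ^ (2 * padicValNat p (AddSubgroup.zmultiples P).index))
    -- the pair: (ram), not (T2α), (β), even conductor
    (hX : ClassX11b W p) (hram : Ram W p)
    (hα : ¬ (W.HasSplitMultiplicativeReductionAtPrime p ∧ p ∣ padicValInt p W.minimalDiscriminantInt))
    (hβ : ∀ (ℓ : ℕ) [Fact ℓ.Prime], ¬ W.HasGoodReductionAtPrime ℓ → ¬ Mult W ℓ →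
      ¬ p ∣ (W.baseChange ℚ_[ℓ]).localTamagawaNumber ℤ_[ℓ])
    (h2N : 2 ∣ W.conductorNorm ℤ) : BSDp W p := by
  have hsurj : Surj W p := surj_of_irr_of_ram W p hX.2.2.2 hram
  refine Typed.bsdp_of_missingPPartAt W p hGZK (by rw [hX.1]) ?_
  exact Typed.missingPPartAt_of_lower_of_upper W p
    (P2.missingLowerBoundAt_of_openInputOddAt W p hGZ hKo hWu hGZK hmod hnf hHL hMaz hPT hEP hA hX
      hsurj)
    (missingUpperBoundAt_of_classX11b_of_ram_of_beta_of_two_dvd_odd W p hSk hGZK hmod hnf hFH hSh hX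
      hram hα hβ h2N)

end BSD

/-- **The `p = 3` row**: `BSD(E,3)` for every `E` with `(E,3) ∈` X11b (`3 ∥ N`, `E[3]` irreducible,
`ord_{s=1} L(E,s) = 1`), a (ram) prime, NOT split-and-peu-ramifié at `3`, `3 ∤ c_ℓ(E)` at every
ADDITIVE prime `ℓ` (no rational Kodaira type IV / IV*), and `2 ∣ N_E` — from the published facts,
THE open input at `p = 3` (`P2OpenInputOnTreeOddAt W 3`: NO source, not even announced — Howard
"`p ∤ 6N`", Castella / Skinner–Zhang / Fouquet–Wan "`p ≥ 5`") and (T2♯)@3 the two Shimura-curve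
shapes at the JSW fields of `(E,3)`. The `p = 3` case of `P2.bsdp_of_ram_of_beta_of_two_dvd_odd`.
CONDITIONAL; nothing booked; X11 ∧ `r = 1` at `p = 3` stays CONSTRUCTION-SHAPED.
[cite: JetchevSkinnerWan2017, §7.4.1–7.4.2 (pp. 30–31), Thm. 4.4.1 (p. 19)]
[cite: Castella2018, Thm. 2.3 (p. 5), Thm. 3.2 (p. 9)] [cite: Skinner2016PacificMC, Thm. C (§1) and footnote 1]
[cite: Wuthrich2014, Prop. 21 (p. 400)] [cite: Miller2011LMS, Def. 1.1] -/
theorem P2.bsdp_three_of_ram_of_beta_of_two_dvd [Fact (Nat.Prime 3)]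
    (hGZ : ∀ (N : ℕ) [NeZero N] (W : WeierstrassCurve ℚ) (K : Type) [Field K] [NumberField K],
      gross_zagier N W K)
    (hKo : ∀ (N : ℕ) [NeZero N] (W : WeierstrassCurve ℚ) (K : Type) [Field K] [NumberField K],
      kolyvagin N W K)
    (hSk : Skinner2016.thmC_padicValRat_bsd_rank_zero) (hWu : sha_dvd_analyticSha)
    (hGZK : rank_eq_analyticRank_of_analyticRank_le_one) (hmod : hasEntireLFunction_rat)
    (hnf : exists_isNewformOf) (hHL : HoffsteinLuo1997_exists_twist_L_one_ne_zero)
    (hFH : friedbergHoffstein_exists_twist_ne_zero_inertAt)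
    (hMaz : mazur_not_dvd_maninConstant_of_odd)
    (hPT : ∀ (K : Type) [Field K] [NumberField K], poitouTate_sum_localTatePairing_eq_zero K)
    (hEP : ∀ (K : Type) [Field K] [NumberField K] (v : HeightOneSpectrum (𝓞 K)),
      localEulerPoincareCharacteristic (v.adicCompletion K))
    (W : WeierstrassCurve ℚ) [W.IsElliptic] [W.IsGloballyMinimal]
    -- THE open input at `p = 3` (no source)
    (hA : P2OpenInputOnTreeOddAt W 3)
    -- (T2♯)@3 the two Shimura-curve shapes at every JSW field of `(E, 3)`
    (hSh : ∀ (K : Type) [Field K] [NumberField K] (S : Finset ℕ)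
      (Wd : WeierstrassCurve ℚ) [Wd.IsElliptic] [Wd.IsGloballyMinimal] (Cd : VariableChange ℚ),
      IsImaginaryQuadratic K → Even S.card →
      (∀ ℓ ∈ S, ∃ _ : Fact ℓ.Prime, Mult W ℓ ∧
        ((ℓ ≠ 2 ∧ jacobiSym (NumberField.discr K) ℓ = -1) ∨ (ℓ = 2 ∧ NumberField.discr K % 8 = 5))) →
      (∀ (ℓ : ℕ) [Fact ℓ.Prime], ¬ W.HasGoodReductionAtPrime ℓ → ℓ ∉ S →
        IsSquare (algebraMap ℚ ℚ_[ℓ] (NumberField.discr K : ℚ))) →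
      (∀ (ℓ : ℕ) [Fact ℓ.Prime], ℓ ∉ S → W.HasSplitMultiplicativeReductionAtPrime ℓ →
        ¬ 3 ∣ padicValInt ℓ W.minimalDiscriminantInt) →
      Cd • W.quadraticTwist (NumberField.discr K : ℚ) = Wd →
      (W.quadraticTwist (NumberField.discr K : ℚ)).entireLFunction 1 ≠ 0 →
      ∃ P : (W.baseChange K).toAffine.Point,
        (∃ qE qd : ℚ, qE ≠ 0 ∧ qd ≠ 0 ∧
          W.leadingLCoeff / ((W.realPeriodRat : ℂ) * (W.regulator : ℂ)) = (qE : ℂ) ∧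
          Wd.entireLFunction 1 / (Wd.realPeriodRat : ℂ) = (qd : ℂ) ∧
          (2 * padicValNat 3 (AddSubgroup.zmultiples P).index : ℤ) +
              (∑ ℓ ∈ S, padicValNat 3 (padicValInt ℓ W.minimalDiscriminantInt) : ℕ) =
            padicValRat 3 qE + padicValRat 3 qd) ∧
        Nat.card (AddCommGroup.primaryComponent (W.baseChange K).sha 3) ≤
          3 ^ (2 * padicValNat 3 (AddSubgroup.zmultiples P).index))
    (hX : ClassX11b W 3) (hram : Ram W 3)
    (hα : ¬ (W.HasSplitMultiplicativeReductionAtPrime 3 ∧ 3 ∣ padicValInt 3 W.minimalDiscriminantInt))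
    (hβ : ∀ (ℓ : ℕ) [Fact ℓ.Prime], ¬ W.HasGoodReductionAtPrime ℓ → ¬ Mult W ℓ →
      ¬ 3 ∣ (W.baseChange ℚ_[ℓ]).localTamagawaNumber ℤ_[ℓ])
    (h2N : 2 ∣ W.conductorNorm ℤ) : BSDp W 3 :=
  P2.bsdp_of_ram_of_beta_of_two_dvd_odd W 3 hGZ hKo hSk hWu hGZK hmod hnf hHL hFH hMaz hPT hEP hA hSh hX
    hram hα hβ h2N

end Summit.BirchSwinnertonDyer.Rank1Residual.X11b.Three

end
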